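import Summits.ResolutionOfSingularities.ResolutionOfSingularities.Theorems.PurelyInseparableDim4ResConeCornerTransport
import Summits.ResolutionOfSingularities.ResolutionOfSingularities.Theorems.PurelyInseparableDim4ResConeTwoSlotFlag
import HarnessLib

/-!
# Purely inseparable four-folds — the C∞ GAME STEP: one pure corner step in game coordinates
# (K24b-FRAME, file F2a «exponent maps»: cell `res-dim4-pi`, K2(p) lane, slice B)

[OURS · counted 0 · cell `res-dim4-pi` · K2(p) lane holder res-dim4-p-12 g3's split of K24b by file (bus
2026-08-29 02:23:39Z, owners 03:02:06Z: F2 = res-dim4-p-2 g4), design ruling (iii) 02:51:49Z («local window,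
re-framed at the letter change»); game res-dim4-idea-4 g3/g4 and res-dim4-p-9 g3 (`…ResConeCInfGame`,
`…ResConeCInfGameExact`); transport res-dim4-p-5 g3 (`…ResConeCornerTransport`) and res-dim4-p-7 g2
(`…ResConeShadeOneStep`).]  Nothing here proves K2(p)/K2(5), `NoIsolatedTrap 5 5` or resolution of singularities
in dimension ≥ 4 / characteristic `p` — NOT proved.  AI kernel work, weaker than expert review.

DICTIONARY (fixed coordinates; `j` = the chart letter and `i` = the other ledger letter, `{j, i} = {λ, μ}`;
free letter `u`, contact letter `f`; `d = 4`, `q = 5`, ledger `r = x_j x_i`, order `6`): the game monomial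
`(c, a, b, e)` of res-dim4-p-9 g3's C∞ game (`a` = exponent of the CHART letter) is the `F`-exponent
`E(c,a,b,e) = (a+2)·j + (b+2)·i + e·u + (3−c)·f` (the `G = F/x^r`-monomial `x_j^{a+1} x_i^{b+1} u^e f^{3−c}`;
families `c = 3, 2, 1` ⟷ `f`-degree `0, 1, 2`; degree `a + b + e + 7 − c`).  For ONE pure corner step
`s′ = CentreBlowup.step 5 univ j 0 s`:
* §2 `chartExponent_gameExp` — Hironaka's corner map IS the game's rule `(c,a,b,e) ↦ (c, a+b+e−c, b, e)` (no
  truncation once `c ≤ a+b+e`, which `le_of_coeff_gameExp_ne_zero` gives for every PRESENT game monomial of a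
  straight state); `dead_of_isPthPowerExponent_gameExp` — the cleaning deletes DEAD monomials only (idea-4 (R1)).
* §3 **`coeff_step_zero_gameExp`** (FORWARD law = `hfwdL`, exact, any degree): the coefficient of the live
  image equals the parent coefficient; **`exists_parent_of_coeff_step_zero_gameExp`** (BACKWARD law = the live
  branch of `hevol`): a child game monomial `E(c,a′,b,e)` comes from a parent `E(c,a₀,b,e)` with
  `a′ + c = a₀ + b + e`, OR from the LEDGER EXCEPTION (parent `j`-exponent `1`, `f`-degree `≤ 3`, degree
  `a′ + 7`), which `…_of_ledger` kills under the pair-ledger reading below degree `N > a′ + 7`.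
* §4 TRANSPORT OF THE FRAME `N ↦ N − 4` (a parent has degree ≤ child degree `+ 4` because the kept letter `i`
  has exponent `≥ 1`): `ledger_step_zero` (divisibility by `x_j² x_i²` of the `f`-degree-`≤ 3` part),
  `noCube_step_zero` (no `f³`), `row_step_zero` (any `(u,f)`-bidegree row, e.g. the dead `ū²`-row).
μ-steps are the same theorems with `(j, i) := (μ, λ)`; `gameExp_swap` commutes the two ledger singles.
NOT here: legality / flags (F3, res-dim4-p-3 g3), «no free-letter charts» (F2b) and the window induction (F2c).
bears_on: LADDER-RESOLUTION:D157-DOOR2 (res-dim4-pi · K2(p) · slice B · K24b-FRAME F2a).  Supports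
stmt-ResolutionOfSingularities-16155 (helper).
-/

set_option linter.dupNamespace false -- mandated namespace of this single-conjunct summit

noncomputable section

namespace Summit.ResolutionOfSingularities.ResolutionOfSingularities.Theorems.PIDim4

namespace ResCone

open MvPolynomial Finset
open Literature.AlgebraicGeometry.Resolution
open Literature.AlgebraicGeometry.Resolution.CentreBlowup
open Literature.AlgebraicGeometry.Resolution.Hauser2010
open Literature.AlgebraicGeometry.Resolution.HauserPerlega2019

variable {K : Type} [Field K]

/-! ## 1. Four-letter bookkeeping (res-dim4-p-1's `letters_exhaust`, `quad_apply`, `eq_sum_single_four`,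
`degree_quad` from `…ResConeTwoSlotLegality` / `…ResConeTwoSlotFlag` are reused) -/

section Letters

variable {j i u f : Fin 4} (hji : j ≠ i) (hju : j ≠ u) (hjf : j ≠ f) (hiu : i ≠ u) (hif : i ≠ f) (huf : u ≠ f)
include hji hju hjf hiu hif huf

/-- Degree of an exponent as the sum of its four values. [folklore] -/
theorem degree_eq_quad (d : Fin 4 →₀ ℕ) : d.degree = d j + d i + d u + d f := by
  conv_lhs => rw [eq_sum_single_four hji hju hjf hiu hif huf d]
  exact degree_quad j i u f _ _ _ _

omit hji hju hjf hiu hif huf in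
/-- The game exponent with the two ledger singles commuted (to read a `μ`-step, `(j, i) := (μ, λ)`, in p-9's
slot order `(c, a_λ, b_μ, e)`). [OURS · bookkeeping] -/
theorem gameExp_swap (m n e g : ℕ) :
    (Finsupp.single j m + Finsupp.single i n + Finsupp.single u e + Finsupp.single f g : Fin 4 →₀ ℕ) =
      Finsupp.single i n + Finsupp.single j m + Finsupp.single u e + Finsupp.single f g := by
  rw [add_comm (Finsupp.single j m)]

end Letters

/-! ## 2. The game exponent `E(c,a,b,e) = (a+2)·j + (b+2)·i + e·u + (3−c)·f` and Hironaka's corner map -/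

section GameExp

variable {j i u f : Fin 4} (hji : j ≠ i) (hju : j ≠ u) (hjf : j ≠ f) (hiu : i ≠ u) (hif : i ≠ f) (huf : u ≠ f)
include hji hju hjf hiu hif huf

omit hji hju hjf hiu hif huf in
/-- Degree of the game exponent: `|E(c,a,b,e)| = a + b + e + 7 − c` (`c ≤ 3`). [OURS · bookkeeping] -/
theorem gameExp_degree {c : ℕ} (hc : c ≤ 3) (a b e : ℕ) :
    (Finsupp.single j (a + 2) + Finsupp.single i (b + 2) + Finsupp.single u e + Finsupp.single f (3 - c) :
      Fin 4 →₀ ℕ).degree = a + b + e + 7 - c := by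
  rw [degree_quad j i u f]; omega

/-- **The corner map in game coordinates**: in the chart of the letter `j` (`q = 5`), the exponent
`E(c,a,b,e)` goes to `E(c, a+b+e−c, b, e)` — p-9's λ-rule `(c,a,b,e) ↦ (c, a+b+e−c, b, e)`, with NO truncation as
soon as `c ≤ a + b + e`. [OURS] [cite: CossartJannsenSaito2020, Lemma 13.2] -/
theorem chartExponent_gameExp {c : ℕ} (hc : c ≤ 3) {a b e : ℕ} (hle : c ≤ a + b + e) :
    chartExponent 5 Finset.univ j
        (Finsupp.single j (a + 2) + Finsupp.single i (b + 2) + Finsupp.single u e + Finsupp.single f (3 - c)) =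
      Finsupp.single j (a + b + e - c + 2) + Finsupp.single i (b + 2) + Finsupp.single u e +
        Finsupp.single f (3 - c) := by
  obtain ⟨h1, h2, h3, h4⟩ := quad_apply hji hju hjf hiu hif huf (a + 2) (b + 2) e (3 - c)
  obtain ⟨h1', h2', h3', h4'⟩ := quad_apply hji hju hjf hiu hif huf (a + b + e - c + 2) (b + 2) e (3 - c)
  ext k
  rcases letters_exhaust hji hju hjf hiu hif huf k with h | h | h | h <;> rw [h]
  · rw [chartExponent_univ_apply_self, gameExp_degree (j := j) (i := i) (u := u) (f := f) hc, h1']; omega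
  · rw [chartExponent_apply_of_ne 5 Finset.univ hji.symm, h2, h2']
  · rw [chartExponent_apply_of_ne 5 Finset.univ hju.symm, h3, h3']
  · rw [chartExponent_apply_of_ne 5 Finset.univ hjf.symm, h4, h4']

/-- **Cleaning touches DEAD monomials only** (idea-4 (R1)): a game exponent all of whose entries are multiples
of `5` has `c = 3` and `a, b ≥ 3`, so it is dead (`c ≤ a + e ∧ c ≤ b + e`). [OURS] -/
theorem dead_of_isPthPowerExponent_gameExp {c : ℕ} (hc : c ≤ 3) {a b e : ℕ}
    (h : IsPthPowerExponent 5
      (Finsupp.single j (a + 2) + Finsupp.single i (b + 2) + Finsupp.single u e + Finsupp.single f (3 - c) :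
        Fin 4 →₀ ℕ)) : c ≤ a + e ∧ c ≤ b + e := by
  obtain ⟨h1, h2, h3, h4⟩ := quad_apply hji hju hjf hiu hif huf (a + 2) (b + 2) e (3 - c)
  unfold IsPthPowerExponent at h
  have hj' := h j (by rw [Finsupp.mem_support_iff, h1]; omega)
  have hi' := h i (by rw [Finsupp.mem_support_iff, h2]; omega)
  rw [h1] at hj'
  rw [h2] at hi'
  by_cases hc3 : c = 3
  · subst hc3
    obtain ⟨x, hx⟩ := hj'
    obtain ⟨y, hy⟩ := hi'
    constructor <;> omega
  · have hf' := h f (by rw [Finsupp.mem_support_iff, h4]; omega)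
    rw [h4] at hf'
    obtain ⟨z, hz⟩ := hf'
    omega

end GameExp

/-! ## 3. One pure corner step: the forward and backward laws in game coordinates -/

section Step

variable [DecidableEq K]
variable {j i u f : Fin 4} (hji : j ≠ i) (hju : j ≠ u) (hjf : j ≠ f) (hiu : i ≠ u) (hif : i ≠ f) (huf : u ≠ f)
include hji hju hjf hiu hif huf

/-- **FORWARD LAW** (p-9's `hfwdL`, exact transport, any degree): at a pure corner step in the chart of `j`,
the coefficient of the LIVE image `E(c, a+b+e−c, b, e)` in the child equals the coefficient of `E(c,a,b,e)` in the
parent. [OURS] [cite: Hauser2010, §§F–G] -/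
theorem coeff_step_zero_gameExp (s : State K) (hq : ((5 : ℕ) : ℕ∞) ≤ ordAlong Finset.univ s.F) {c : ℕ}
    (hc : c ≤ 3) {a b e : ℕ} (hle : c ≤ a + b + e) (hlive : ¬ (c ≤ (a + b + e - c) + e ∧ c ≤ b + e)) :
    coeff (Finsupp.single j (a + b + e - c + 2) + Finsupp.single i (b + 2) + Finsupp.single u e +
        Finsupp.single f (3 - c)) (CentreBlowup.step 5 Finset.univ j 0 s).F =
      coeff (Finsupp.single j (a + 2) + Finsupp.single i (b + 2) + Finsupp.single u e + Finsupp.single f (3 - c))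
        s.F := by
  have he : 5 ≤ (Finsupp.single j (a + 2) + Finsupp.single i (b + 2) + Finsupp.single u e +
      Finsupp.single f (3 - c) : Fin 4 →₀ ℕ).degree := by
    rw [gameExp_degree (j := j) (i := i) (u := u) (f := f) hc]; omega
  rw [← chartExponent_gameExp hji hju hjf hiu hif huf hc hle, coeff_step_zero_chartExponent 5 j s hq he, if_neg]
  intro hp
  rw [chartExponent_gameExp hji hju hjf hiu hif huf hc hle] at hp
  exact hlive (dead_of_isPthPowerExponent_gameExp hji hju hjf hiu hif huf hc hp)

omit [DecidableEq K] in
/-- A PRESENT game monomial of a state of order `≥ 6` whose only degree-`6` monomials have `f`-exponent `4`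
(straight C∞ initial monomial `x^r f⁴`) satisfies `c ≤ a + b + e` (no truncation in the corner map). [OURS] -/
theorem le_of_coeff_gameExp_ne_zero (s : State K) (h6 : ∀ d ∈ s.F.support, 6 ≤ d.degree)
    (hstraight : ∀ d ∈ s.F.support, d.degree = 6 → d f = 4) {c : ℕ} (hc : c ≤ 3) {a b e : ℕ}
    (h : coeff (Finsupp.single j (a + 2) + Finsupp.single i (b + 2) + Finsupp.single u e +
      Finsupp.single f (3 - c)) s.F ≠ 0) : c ≤ a + b + e := by
  have hmem := mem_support_iff.mpr h
  have hdeg := h6 _ hmem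
  rw [gameExp_degree (j := j) (i := i) (u := u) (f := f) hc] at hdeg
  by_contra hlt
  have hdeg6 : (Finsupp.single j (a + 2) + Finsupp.single i (b + 2) + Finsupp.single u e +
      Finsupp.single f (3 - c) : Fin 4 →₀ ℕ).degree = 6 := by
    rw [gameExp_degree (j := j) (i := i) (u := u) (f := f) hc]; omega
  have hf4 := hstraight _ hmem hdeg6
  rw [(quad_apply hji hju hjf hiu hif huf (a + 2) (b + 2) e (3 - c)).2.2.2] at hf4
  omega

/-- **FORWARD LAW for present monomials** (`hfwdL` verbatim after unfolding the dictionary): a present game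
monomial with live image has its image present at the child. [OURS] -/
theorem coeff_step_zero_gameExp_ne_zero (s : State K) (hq : ((5 : ℕ) : ℕ∞) ≤ ordAlong Finset.univ s.F)
    (h6 : ∀ d ∈ s.F.support, 6 ≤ d.degree) (hstraight : ∀ d ∈ s.F.support, d.degree = 6 → d f = 4)
    {c : ℕ} (hc : c ≤ 3) {a b e : ℕ}
    (h : coeff (Finsupp.single j (a + 2) + Finsupp.single i (b + 2) + Finsupp.single u e +
      Finsupp.single f (3 - c)) s.F ≠ 0) (hlive : ¬ (c ≤ (a + b + e - c) + e ∧ c ≤ b + e)) :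
    coeff (Finsupp.single j (a + b + e - c + 2) + Finsupp.single i (b + 2) + Finsupp.single u e +
        Finsupp.single f (3 - c)) (CentreBlowup.step 5 Finset.univ j 0 s).F ≠ 0 := by
  rw [coeff_step_zero_gameExp hji hju hjf hiu hif huf s hq hc
    (le_of_coeff_gameExp_ne_zero hji hju hjf hiu hif huf s h6 hstraight hc h) hlive]
  exact h

/-- **BACKWARD LAW** (p-9's `hevol`, live branch, with the ledger exception explicit): a game monomial
`E(c, a′, b, e)` present at the pure-corner child in the chart of `j` is the image of a parent monomial with the
same `(c, b, e)`: either a game monomial `E(c, a₀, b, e)` with `a′ + c = a₀ + b + e` (exact λ-rule), or the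
LEDGER EXCEPTION — a parent monomial with `j`-exponent `1` (its `G`-monomial misses `x_j`), of `f`-degree `3 − c`,
with `a′ + 1 + c = b + e` (degree `a′ + 7`). [OURS] [cite: CossartJannsenSaito2020, Lemma 13.2] -/
theorem exists_parent_of_coeff_step_zero_gameExp (s : State K) (hr1 : ∀ d ∈ s.F.support, 1 ≤ d j) {c : ℕ}
    (hc : c ≤ 3) {a' b e : ℕ}
    (h : coeff (Finsupp.single j (a' + 2) + Finsupp.single i (b + 2) + Finsupp.single u e +
      Finsupp.single f (3 - c)) (CentreBlowup.step 5 Finset.univ j 0 s).F ≠ 0) :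
    (∃ a₀, coeff (Finsupp.single j (a₀ + 2) + Finsupp.single i (b + 2) + Finsupp.single u e +
        Finsupp.single f (3 - c)) s.F ≠ 0 ∧ a' + c = a₀ + b + e) ∨
      (coeff (Finsupp.single j 1 + Finsupp.single i (b + 2) + Finsupp.single u e + Finsupp.single f (3 - c))
          s.F ≠ 0 ∧ a' + 1 + c = b + e) := by
  obtain ⟨d, hd, hdE⟩ := exists_of_mem_support_step_zero j s (mem_support_iff.mpr h)
  obtain ⟨h1, h2, h3, h4⟩ := quad_apply hji hju hjf hiu hif huf (a' + 2) (b + 2) e (3 - c)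
  have hdi : d i = b + 2 := by rw [← chartExponent_apply_of_ne 5 Finset.univ hji.symm d, hdE, h2]
  have hdu : d u = e := by rw [← chartExponent_apply_of_ne 5 Finset.univ hju.symm d, hdE, h3]
  have hdf : d f = 3 - c := by rw [← chartExponent_apply_of_ne 5 Finset.univ hjf.symm d, hdE, h4]
  have hdj : d.degree - 5 = a' + 2 := by rw [← chartExponent_univ_apply_self 5 j d, hdE, h1]
  have hdeg := degree_eq_quad hji hju hjf hiu hif huf d
  rw [hdi, hdu, hdf] at hdeg
  have hd1 := hr1 d hd
  have hdq := eq_sum_single_four hji hju hjf hiu hif huf d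
  rw [hdi, hdu, hdf] at hdq
  by_cases hj2 : 2 ≤ d j
  · refine Or.inl ⟨d j - 2, ?_, by omega⟩
    rw [show d j - 2 + 2 = d j by omega, ← hdq]
    exact mem_support_iff.mp hd
  · have hj1 : d j = 1 := by omega
    refine Or.inr ⟨?_, by omega⟩
    rw [← hj1, ← hdq]
    exact mem_support_iff.mp hd

/-- **BACKWARD LAW under the ledger reading**: if every parent monomial of `f`-degree `≤ 3` and degree `< N`
has `j`-exponent `≥ 2` (the pair-ledger divisibility of the frame, exact below degree `N`), then a child game
monomial `E(c, a′, b, e)` with `a′ + 7 < N` has a GAME parent: `∃ a₀, E(c, a₀, b, e)` present and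
`a′ + c = a₀ + b + e`. [OURS] -/
theorem exists_parent_of_coeff_step_zero_gameExp_of_ledger (s : State K) (hr1 : ∀ d ∈ s.F.support, 1 ≤ d j)
    {N : ℕ} (hled : ∀ d ∈ s.F.support, d f ≤ 3 → d.degree < N → 2 ≤ d j) {c : ℕ} (hc : c ≤ 3) {a' b e : ℕ}
    (hN : a' + 7 < N)
    (h : coeff (Finsupp.single j (a' + 2) + Finsupp.single i (b + 2) + Finsupp.single u e +
      Finsupp.single f (3 - c)) (CentreBlowup.step 5 Finset.univ j 0 s).F ≠ 0) :
    ∃ a₀, coeff (Finsupp.single j (a₀ + 2) + Finsupp.single i (b + 2) + Finsupp.single u e +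
        Finsupp.single f (3 - c)) s.F ≠ 0 ∧ a' + c = a₀ + b + e := by
  rcases exists_parent_of_coeff_step_zero_gameExp hji hju hjf hiu hif huf s hr1 hc h with h' | ⟨h', heq⟩
  · exact h'
  · exfalso
    obtain ⟨h1, h2, h3, h4⟩ := quad_apply hji hju hjf hiu hif huf 1 (b + 2) e (3 - c)
    have hmem := mem_support_iff.mpr h'
    have h2j := hled _ hmem (by rw [h4]; omega) (by rw [degree_quad j i u f]; omega)
    rw [h1] at h2j
    omega

/-! ## 4. Transport of the frame readings below degree `N ↦ N − 4` -/

/-- Degree bookkeeping of the corner map: a child monomial has degree at least its parent's degree minus `4`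
(the kept ledger letter `i` has exponent `≥ 1`). [OURS · bookkeeping] -/
theorem degree_le_degree_chartExponent_add {d : Fin 4 →₀ ℕ} (h5 : 5 ≤ d.degree) (hi1 : 1 ≤ d i) :
    d.degree ≤ (chartExponent 5 Finset.univ j d).degree + 4 := by
  have hdeg := degree_eq_quad hji hju hjf hiu hif huf d
  have hdeg' := degree_eq_quad hji hju hjf hiu hif huf (chartExponent 5 Finset.univ j d)
  rw [chartExponent_univ_apply_self, chartExponent_apply_of_ne 5 Finset.univ hji.symm,
    chartExponent_apply_of_ne 5 Finset.univ hju.symm, chartExponent_apply_of_ne 5 Finset.univ hjf.symm] at hdeg'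
  omega

/-- **LEDGER TRANSPORT**: if below degree `N` every parent monomial of `f`-degree `≤ 3` is divisible by
`x_j² x_i²` (in `F`-coordinates; `x_j x_i` in `G = F / x^r`) and has degree `≥ 7` (straight initial monomial
`x^r f⁴`), then below degree `N − 4` the same holds at the pure-corner child in the chart of `j`. [OURS] -/
theorem ledger_step_zero (s : State K) (hi1 : ∀ d ∈ s.F.support, 1 ≤ d i)
    (h7 : ∀ d ∈ s.F.support, d f ≤ 3 → 7 ≤ d.degree) {N : ℕ}
    (hled : ∀ d ∈ s.F.support, d f ≤ 3 → d.degree < N → 2 ≤ d j ∧ 2 ≤ d i) :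
    ∀ d' ∈ (CentreBlowup.step 5 Finset.univ j 0 s).F.support, d' f ≤ 3 → d'.degree < N - 4 →
      2 ≤ d' j ∧ 2 ≤ d' i := by
  intro d' hd' hf' hN'
  obtain ⟨d, hd, hdE⟩ := exists_of_mem_support_step_zero j s hd'
  subst hdE
  rw [chartExponent_apply_of_ne 5 Finset.univ hjf.symm] at hf'
  have hdeg7 := h7 d hd hf'
  have hle := degree_le_degree_chartExponent_add hji hju hjf hiu hif huf (d := d) (by omega) (hi1 d hd)
  have h2 := hled d hd hf' (by omega)
  rw [chartExponent_univ_apply_self, chartExponent_apply_of_ne 5 Finset.univ hji.symm]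
  exact ⟨by omega, h2.2⟩

/-- **NO-CUBE TRANSPORT**: if below degree `N` the parent has no monomial of `f`-degree `3` (the `v̄³`-family
`A₃` is absent from the normal form), then below degree `N − 4` neither has the pure-corner child. [OURS] -/
theorem noCube_step_zero (s : State K) (hi1 : ∀ d ∈ s.F.support, 1 ≤ d i)
    (h5 : ∀ d ∈ s.F.support, 5 ≤ d.degree) {N : ℕ}
    (hA3 : ∀ d ∈ s.F.support, d.degree < N → d f ≠ 3) :
    ∀ d' ∈ (CentreBlowup.step 5 Finset.univ j 0 s).F.support, d'.degree < N - 4 → d' f ≠ 3 := by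
  intro d' hd' hN'
  obtain ⟨d, hd, hdE⟩ := exists_of_mem_support_step_zero j s hd'
  subst hdE
  rw [chartExponent_apply_of_ne 5 Finset.univ hjf.symm]
  have hle := degree_le_degree_chartExponent_add hji hju hjf hiu hif huf (d := d) (h5 d hd) (hi1 d hd)
  exact hA3 d hd (by omega)

/-- **ROW TRANSPORT at fixed `(u, f)`-bidegree and bounded degree** (e.g. the dead `ū²`-row, any reading that
only names `u`- and `f`-exponents): absence below degree `N` at the parent gives absence below `N − 4` at the
child. [OURS] -/
theorem row_step_zero (s : State K) (hi1 : ∀ d ∈ s.F.support, 1 ≤ d i)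
    (h5 : ∀ d ∈ s.F.support, 5 ≤ d.degree) {N eu ef : ℕ}
    (hrow : ∀ d ∈ s.F.support, d.degree < N → ¬ (d u = eu ∧ d f = ef)) :
    ∀ d' ∈ (CentreBlowup.step 5 Finset.univ j 0 s).F.support, d'.degree < N - 4 → ¬ (d' u = eu ∧ d' f = ef) := by
  intro d' hd' hN'
  obtain ⟨d, hd, hdE⟩ := exists_of_mem_support_step_zero j s hd'
  subst hdE
  rw [chartExponent_apply_of_ne 5 Finset.univ hjf.symm, chartExponent_apply_of_ne 5 Finset.univ hju.symm]
  have hle := degree_le_degree_chartExponent_add hji hju hjf hiu hif huf (d := d) (h5 d hd) (hi1 d hd)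
  exact hrow d hd (by omega)

end Step

end ResCone

end Summit.ResolutionOfSingularities.ResolutionOfSingularities.Theorems.PIDim4

end
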